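import Mathlib.NumberTheory.LocalField.Basic
import Mathlib.LinearAlgebra.Matrix.GeneralLinearGroup.Defs
import Mathlib.LinearAlgebra.Matrix.ToLin
import Mathlib.LinearAlgebra.Determinant
import Mathlib.Topology.Algebra.Module.ModuleTopology
import Literature.NumberTheory.Automorphic.SmoothRepresentation
import Literature.NumberTheory.Automorphic.MatrixCoefficients
import Literature.NumberTheory.Automorphic.HeckeAlgebra
import Literature.NumberTheory.Automorphic.ReductiveGroupData
import Literature.NumberTheory.Automorphic.SatakeParametersGL
import Literature.NumberTheory.Automorphic.LParameter
import Literature.NumberTheory.GaloisRepresentations.WeilDeligneRep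
import Literature.NumberTheory.GaloisRepresentations.LocalClassFieldTheory
import HarnessLib

-- D-0014 sorry-sweep (operator, 2026-08-13): sorried theorems -> named facts `def X : Prop`; partial proofs preserved in comments
-- provenance: harness21/H21/H21/Statements/Lang/PAdicReps.lean @ 3db9903 (interim HEAD d8f2665); M5 mechanical rewrite
/-!
# Langlands family (`lang`): smooth representations of `p`-adic groups
(statements **lang.S15**, **lang.S16**, **lang.S17**, **lang.S09**)

Let `F` be a non-archimedean local field (`[IsNonarchimedeanLocalField F]`, Mathlib) and
`G = GL_n(F)` (`GL (Fin n) F` with its matrix topology), `K₀ = GL_n(𝒪_F) = glInt n F`.  This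
file collects the target statements of the Langlands family about smooth complex
representations of `p`-adic groups, all phrased with the accepted AutomorphicAxiomatic prelude
(items C2 `SmoothRepresentation`, C3 `MatrixCoefficients`, C4 `HeckeAlgebra`,
C6 `ReductiveGroupData`, C7 `SatakeParametersGL`, C5 `LParameter`) and the GalRep prelude
(`WeilDeligneRep`, `LocalClassFieldTheory`).

* **lang.S15** (Bernstein–Zelevinsky, Russian Math. Surveys 31 (1976), §2; Bushnell–Henniart,
  *The local Langlands conjecture for `GL(2)`*, §§1–2).  The inventory item is a *definition*
  (smooth, admissible, irreducible, contragredient, supercuspidal); the definitions are the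
  prelude's `Representation.IsSmooth`, `IsAdmissible`, Mathlib's `Representation.IsIrreducible`,
  `Representation.contragredientRep`, `Representation.IsSupercuspidal`.  Restated here, with the
  bold id, as sanity theorems for `GL_n(F)`: `isSmooth_iff_continuous` (proved),
  `isAdmissible_iff` (proved, `Iff.rfl`), `isSupercuspidal_isAdmissible`,
  `contragredient_isAdmissible` (known theorems, `sorry`).
* **lang.S16** (Jacquet 1975; Bernstein 1974; Renard VI.2.2).  Jacquet's admissibility theorem,
  asserted (outline D1) for the honest instances only: `jacquetAdmissibility_gl` and
  `jacquetAdmissibility_quaternionUnits` (units of a finite-dimensional division algebra over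
  `F`); the general shape is the untagged prelude `JacquetAdmissibilityStatement` /
  `ConnectedReductiveGroupData`.
* **lang.S17** (Satake 1963; Cartier, Corvallis 1979, §IV; Gross 1998).  The Satake
  isomorphism for `GL_n` and its consequences: `satake_gl`, `satakeIsomorphismStatement_gl`,
  `isGelfandPair_glInt`, `existsUnique_isSatakeParameter` (unramified irreducible admissible
  `π` ↔ unique Satake parameter = semisimple conjugacy class in `GL_n(ℂ)`).  All four are proved
  from the prelude theorems of the same name in `Literature.Automorphic` (which are `sorry` there).
* **lang.S09** (Harris–Taylor 2001, Thm A; Henniart 2000; Scholze 2013) — **weak form**: the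
  local Langlands correspondence for `GL_n(F)`, `localLanglands_gl_weak`, as the existence of a
  family `rec_n` from complex representations of `GL_n(F)` to `n`-dimensional Weil–Deligne
  representations which is Frobenius-semisimple-valued, isomorphism invariant, bijective from
  smooth irreducibles onto Frobenius-semisimple classes, given by local class field theory for
  `n = 1`, compatible with character twists and central characters, and matching Satake
  parameters with geometric-Frobenius eigenvalues on unramified representations.  Preservation
  of `L`- and `ε`-factors of pairs, hence Henniart's uniqueness, is NOT stated (notion
  `rankin_selberg_local_factors` is tier L).

## Mathlib search

Mathlib (this pin) has `IsNonarchimedeanLocalField`, `Matrix.GeneralLinearGroup` with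
`GeneralLinearGroup.det`, `GeneralLinearGroup.scalar` (and `center_eq_range_scalar`),
`Representation`, `Representation.Equiv`, `Representation.IsIrreducible`, `LinearMap.det`,
`LinearMap.toMatrix'`, `IsModuleTopology`, `Valuation.IsUniformizer`, all used below; it has no
smooth/admissible representations of topological groups, no Hecke algebras of locally profinite
groups beyond the product-less `HeckeRing`, no Satake isomorphism, no Weil–Deligne
representations and no local Langlands correspondence (`rg -i 'langlands'`, `rg -i satake`,
`rg -i 'Weil.?Deligne'`, `rg -i admissible RepresentationTheory/` give nothing relevant).
Nothing here duplicates a Mathlib declaration.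

## Design choices

* All declarations live in `namespace Literature.Lang`, `open Literature.Automorphic`.
* The only new definition is `wdTwist r ψ hψ`, the twist of a Weil–Deligne representation by a
  smooth character `ψ : W_F →* Cˣ` (open kernel), needed to phrase (d) and (e) of lang.S09; it
  is a real construction (continuity and the Weil–Deligne relation are proved).  Characters of
  `Fˣ` are unbundled smooth characters `χ : Fˣ →* ℂˣ` with `IsOpen (χ.ker : Set Fˣ)`
  (for `Fˣ`, equivalently continuous, since `ℂˣ` has no small subgroups), matching the
  unbundled `Representation` + `IsSmooth` style of the prelude; `χ ∘ d.artin` is then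
  `d.recGL1 χ` of `LocalArtinData` and has open kernel by `isOpen_ker_comp_artin` (proved).
* `localLanglands_gl_weak` produces the whole family `rec = (rec_n)_{n : ℕ}` in one existential
  (the inventory text: "a family of bijections"), rather than one `rec` for a fixed `n` as the
  outline sketch has it, because clause (d) concerns `rec_1`; every other clause is stated
  `∀ n`.  Representation spaces are `V : Type` (outline).  `rec_n` is total; its values off
  smooth irreducible `ρ` are unconstrained junk except for the harmless clauses (a), (b).
* Frobenius convention in (g): with `LocalArtinData` (geometric Frobenius `deg w = -1` ↦
  uniformiser, Deligne/Harris–Taylor) and the unitary Satake normalisation of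
  `IsSatakeParameter` (`T_i ↔ q^{i(n-i)/2} e_i(α)`, so for `n = 1`, `α = {χ(ϖ)}`), clause (d)
  forces the *geometric* Frobenius of `rec_n ρ` to have eigenvalues `α`; the outline's informal
  "arithmetic Frobenius" would contradict (d), so (g) uses `deg w = -1`.
* `jacquetAdmissibility_quaternionUnits` is stated for any finite-dimensional division algebra
  `D` over `F` with the `F`-module topology (`IsModuleTopology F D`), which covers quaternion
  division algebras without importing the adelic quaternion prelude; `Dˣ` is the `Points` of
  `ConnectedReductiveGroupData.quaternionUnits F D`.
* lang.S15's two non-definitional sanity facts are specialised to `GL_n(F)` and left `sorry`: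
  deducing them from the general prelude theorems would need the instances
  `NonarchimedeanGroup / LocallyCompactSpace / T2Space / SecondCountableTopology (GL (Fin n) F)`,
  which neither Mathlib nor the prelude provides yet.

## References

* M. Harris, R. Taylor, *The geometry and cohomology of some simple Shimura varieties*, Annals
  of Math. Studies 151 (2001), Theorem A.
* G. Henniart, *Une preuve simple des conjectures de Langlands pour `GL(n)` sur un corps
  `p`-adique*, Invent. Math. 139 (2000).
* P. Scholze, *The local Langlands correspondence for `GL_n` over `p`-adic fields*, Invent.
  Math. 192 (2013), Theorem 1.2.
* I. N. Bernstein, A. V. Zelevinsky, Russian Math. Surveys 31 (1976), §§2–3.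
* C. J. Bushnell, G. Henniart, *The local Langlands conjecture for `GL(2)`* (2006), §§1–2, 33.
* H. Jacquet, C. R. Acad. Sci. 280 (1975); D. Renard, *Représentations des groupes réductifs
  p-adiques* (2010), VI.2.2.
* I. Satake, Publ. IHÉS 18 (1963); P. Cartier, Corvallis 1979, part 1, §IV; B. Gross, *On the
  Satake isomorphism* (1998).
-/

noncomputable section

open scoped MatrixGroups
open Matrix ValuativeRel

namespace Literature.NumberTheory.Automorphic

open GaloisRepresentations.WeilGroup

universe u

variable {F : Type u} [Field F] [ValuativeRel F] [TopologicalSpace F] [IsNonarchimedeanLocalField F]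

/-! ## lang.S15: smooth, admissible, contragredient, supercuspidal (sanity restatements) -/

section S15

variable {n : ℕ} {V : Type*} [AddCommGroup V] [Module ℂ V] (ρ : Representation ℂ (GL (Fin n) F) V)

/-- **lang.S15** (Bernstein–Zelevinsky, Russian Math. Surveys 31 (1976), §2.1;
Bushnell–Henniart, *The local Langlands conjecture for `GL(2)`*, §1.1, Remark).
A representation `ρ` of `GL_n(F)` on a complex vector space `V` (no topology) is **smooth**
(every vector has open stabiliser, `Representation.IsSmooth`) iff the action map
`GL_n(F) × V → V` is jointly continuous for the *discrete* topology on `V`.  Definitional target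
restated as a sanity theorem; it is `Representation.isSmooth_iff_continuous` of prelude item
C2. [folklore] -/
theorem isSmooth_iff_continuous [TopologicalSpace V] [DiscreteTopology V] :
    ρ.IsSmooth ↔ Continuous fun p : GL (Fin n) F × V => ρ p.1 p.2 :=
  ρ.isSmooth_iff_continuous

omit [ValuativeRel F] [IsNonarchimedeanLocalField F] in
/-- **lang.S15** (Bernstein–Zelevinsky 1976, Definition 2.1(b); Bushnell–Henniart §2.1).
A representation `ρ` of `GL_n(F)` is **admissible** iff it is smooth and, for every compact
open subgroup `K`, the space `V^K` of `K`-fixed vectors is finite-dimensional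
(`Module.Finite ℂ`).  Definitional target restated (unfolding of
`Representation.IsAdmissible`, prelude item C2). [cite: BernsteinZelevinsky1976, Definition 2.1(b] -/
theorem isAdmissible_iff :
    ρ.IsAdmissible ↔ ρ.IsSmooth ∧ ∀ K : OpenSubgroup (GL (Fin n) F),
      IsCompact (K : Set (GL (Fin n) F)) → Module.Finite ℂ (ρ.fixedPoints (K : Subgroup _)) :=
  Iff.rfl

/-- **lang.S15** (Bernstein–Zelevinsky 1976, §3.21; Bushnell–Henniart §10.2, Corollary;
Casselman, *Introduction to the theory of admissible representations*, Theorem 5.3.1).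
An irreducible smooth **supercuspidal** representation of `GL_n(F)` (all smooth matrix
coefficients compactly supported modulo the centre, `Representation.IsSupercuspidal` of prelude
item C3) is admissible.  (The prelude states this for any second-countable locally profinite
group as `Representation.IsSupercuspidal.isAdmissible`; here it is specialised to `GL_n(F)`.) [cite: BernsteinZelevinsky1976, §3.21] -/
def isSupercuspidal_isAdmissible : Prop :=
  ∀ [ρ.IsIrreducible] (hsmooth : ρ.IsSmooth) (h : ρ.IsSupercuspidal),
    ρ.IsAdmissible

/-- **lang.S15** (Bernstein–Zelevinsky 1976, §2.13 and Proposition 2.14; Bushnell–Henniart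
§§2.8–2.10).  The smooth **contragredient** `ρ̃` (`Representation.contragredientRep`, prelude
item C2: the smooth vectors of the algebraic dual) of an admissible representation of `GL_n(F)`
is admissible.  (General locally profinite version: `Representation.isAdmissible_contragredient`.)
[cite: BernsteinZelevinsky1976, §2.13 and Proposition 2.14] -/
def contragredient_isAdmissible : Prop :=
  ∀ (hρ : ρ.IsAdmissible),
    ρ.contragredientRep.IsAdmissible

end S15

/-! ## lang.S16: Jacquet's admissibility theorem -/

section S16

variable (F)

/-- **lang.S16** (Jacquet, C. R. Acad. Sci. 280 (1975); Bernstein, Funct. Anal. Appl. 8 (1974);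
Bernstein–Zelevinsky 1976, §3.25; Renard, *Représentations des groupes réductifs p-adiques*,
VI.2.2).  **Every irreducible smooth complex representation of `GL_n(F)` is admissible**:
`JacquetAdmissibilityStatement (GL (Fin n) F)` (prelude item C6).  The theorem holds for every
connected reductive `G/F`; per outline D1 it is asserted only for the honest instances
(`GL_n`, here, and `Dˣ`, below), the general shape being the untagged
`Literature.Automorphic.JacquetAdmissibilityStatement G` for `G = (D : ConnectedReductiveGroupData F).Points`.
Binder repair (2026-08-15): `F` and its local-field structure
`[Field F] [ValuativeRel F] [TopologicalSpace F] [IsNonarchimedeanLocalField F]` are explicit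
binders of this `def` — as section variables the unused `[ValuativeRel F] [IsNonarchimedeanLocalField F]`
were dropped by Lean, which made the constant the (false) statement about an arbitrary
topological field `F`; the same repair as `Representation.isAdmissible_jacquetGL` (file
`ParabolicGL`) and `jacquetGL_isAdmissible` (file `ParabolicInduction`).  Users write
`jacquetAdmissibility_gl F` as before. [cite: BernsteinZelevinsky1976, §3.25] -/
def jacquetAdmissibility_gl (F : Type u) [Field F] [ValuativeRel F] [TopologicalSpace F]
    [IsNonarchimedeanLocalField F] : Prop :=
  ∀ (n : ℕ),
    JacquetAdmissibilityStatement (GL (Fin n) F)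

/-- **lang.S16** (Jacquet 1975; Bernstein 1974; Renard VI.2.2; for `Dˣ` compact modulo centre
see also Bushnell–Henniart §53–54).  **Every irreducible smooth complex representation of `Dˣ`
is admissible**, for `D` a finite-dimensional division algebra over `F` with its `F`-module
topology (e.g. a quaternion division algebra: the datum
`ConnectedReductiveGroupData.quaternionUnits F D`, whose `Points` is `Dˣ`).  Untagged general
shape: `Literature.NumberTheory.Automorphic.JacquetAdmissibilityStatement`.  Binder repair (2026-08-15):
`F` and its local-field structure are explicit binders of this `def` (the unused section
variables `[ValuativeRel F] [IsNonarchimedeanLocalField F]` were dropped, cf.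
`jacquetAdmissibility_gl`); its discharge
`jacquetAdmissibility_quaternionUnits_holds` (file `PAdicRepsQuaternionUnitsProofs`) is unaffected.
[cite: Jacquet1975] -/
def jacquetAdmissibility_quaternionUnits (F : Type u) [Field F] [ValuativeRel F] [TopologicalSpace F]
    [IsNonarchimedeanLocalField F] : Prop :=
  ∀ (D : Type u) [DivisionRing D] [Algebra F D] [FiniteDimensional F D] [TopologicalSpace D] [IsTopologicalRing D] [IsModuleTopology F D],
    JacquetAdmissibilityStatement Dˣ

end S16

/-! ## lang.S17: the Satake isomorphism for `GL_n` -/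

section S17

variable (n : ℕ) (F)

/-- **lang.S17** (Satake, Publ. IHÉS 18 (1963); Cartier, Corvallis 1979, §IV.2, Theorem 4.1
and Example; Gross, *On the Satake isomorphism* (1998), §3).  **Satake isomorphism for
`GL_n`**: the spherical Hecke algebra `ℋ(GL_n(F), GL_n(𝒪_F))` over `ℂ` is isomorphic as a
`ℂ`-algebra to the symmetric Laurent polynomials `ℂ[x_1^{±1},…,x_n^{±1}]^{S_n} = ℂ[X_*(T)]^W`
(`symmLaurent n`, prelude item C7).  Restates `Literature.NumberTheory.Automorphic.SatakeParametersGL.satake_gl`.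
Binder repair (2026-08-15): `F`, its local-field structure and `n` are explicit binders of this
`def` (the unused section variables `[TopologicalSpace F] [IsNonarchimedeanLocalField F]` were
dropped by Lean, leaving a statement about an arbitrary valued field, false for the trivial
valuation); users write `PAdicReps.satake_gl F n` as before. [cite: Corvallis1979, §IV.2  Theorem 4.1 and Example] -/
def PAdicReps.satake_gl (F : Type u) [Field F] [ValuativeRel F] [TopologicalSpace F]
    [IsNonarchimedeanLocalField F] (n : ℕ) : Prop :=
  Nonempty (heckeAlgebra ℂ (GL (Fin n) F) (glInt n F) ≃ₐ[ℂ] symmLaurent n)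

/- interim proof relied on results that are now named facts (D-0014); demoted to a fact by the D-0014 sorry-sweep, proof preserved:
:=
  Literature.Automorphic.satake_gl n F
-/

/-- **lang.S17** (Satake 1963; Cartier, Corvallis 1979, Theorem 4.1).  The general Satake
statement `ℋ(G(F), K) ≃ ℂ[X_*(A)]^W` for `K` hyperspecial
(`Literature.NumberTheory.Automorphic.SatakeIsomorphismStatement`, untagged shape of prelude item C6) holds for the
datum `GL_n / F` and `K = GL_n(𝒪_F)`.  Restates `Literature.NumberTheory.Automorphic.SatakeParametersGL.satakeIsomorphismStatement_gl`. [cite: Satake1963] -/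
def PAdicReps.satakeIsomorphismStatement_gl : Prop :=
  SatakeIsomorphismStatement (ConnectedReductiveGroupData.gl n F) (glInt n F)

/- interim proof relied on results that are now named facts (D-0014); demoted to a fact by the D-0014 sorry-sweep, proof preserved:
:=
  Literature.Automorphic.satakeIsomorphismStatement_gl n F
-/

/-- **lang.S17** (Cartier, Corvallis 1979, §IV.1; Satake 1963; Shimura, *Introduction to the
arithmetic theory of automorphic functions*, Theorem 3.20).  `(GL_n(F), GL_n(𝒪_F))` is a
**Gelfand pair**: the spherical Hecke algebra is commutative.  Restates
`Literature.NumberTheory.Automorphic.SatakeParametersGL.isGelfandPair_glInt`.  Binder repair (2026-08-15):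
`F`, its local-field structure and `n` are explicit binders of this `def` (the unused section
variables `[TopologicalSpace F] [IsNonarchimedeanLocalField F]` were dropped by Lean); its
discharge `PAdicReps.isGelfandPair_glInt_holds` (file `PAdicRepsSatakeProofs`) is unaffected.
[cite: Corvallis1979, §IV.1] -/
def PAdicReps.isGelfandPair_glInt (F : Type u) [Field F] [ValuativeRel F] [TopologicalSpace F]
    [IsNonarchimedeanLocalField F] (n : ℕ) : Prop :=
  IsGelfandPair ℂ (GL (Fin n) F) (glInt n F)

/- interim proof relied on results that are now named facts (D-0014); demoted to a fact by the D-0014 sorry-sweep, proof preserved: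
:=
  Literature.Automorphic.isGelfandPair_glInt n F
-/

variable {n F}
variable {V : Type*} [AddCommGroup V] [Module ℂ V] (ρ : Representation ℂ (GL (Fin n) F) V)

/-- **lang.S17** (Cartier, Corvallis 1979, §IV.4; Satake 1963; Gross 1998, §§3, 6; Borel,
Corvallis 1979, §§7, 10.4).  **Unramified representations ↔ semisimple conjugacy classes**: an
irreducible admissible unramified representation of `GL_n(F)` has a unique multiset
`α = {α_1,…,α_n}` of Satake parameters (`IsSatakeParameter`, prelude item C7), i.e. corresponds
to a unique semisimple conjugacy class `diag(α)` in `Ĝ = GL_n(ℂ)`.  Restates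
`Literature.NumberTheory.Automorphic.SatakeParametersGL.existsUnique_isSatakeParameter`. [cite: Corvallis1979, §IV.4] -/
def PAdicReps.existsUnique_isSatakeParameter : Prop :=
  ∀ [ρ.IsIrreducible] (hadm : ρ.IsAdmissible) (hK : ρ.IsUnramified (glInt n F)) {ϖ : Fˣ} (hϖ : (valuation F).IsUniformizer (ϖ : F)),
    ∃! α : Multiset ℂ, IsSatakeParameter ρ ϖ α

/- interim proof relied on results that are now named facts (D-0014); demoted to a fact by the D-0014 sorry-sweep, proof preserved:
:=
  Literature.Automorphic.existsUnique_isSatakeParameter ρ hadm hK hϖ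
-/

end S17

/-! ## lang.S09: the local Langlands correspondence for `GL_n` (weak form) -/

section WDTwist

variable {C : Type*} [Field C] [CharZero C] {W : Type*} [AddCommGroup W] [Module C W]

/-- The **twist** `r ⊗ ψ` of a Weil–Deligne representation `r = (ρ, N)` by a smooth character
`ψ : W_F →* Cˣ` (open kernel): `(ρ ⊗ ψ, N)` with `(ρ ⊗ ψ)(w) = ψ(w) ρ(w)`
(`Representation.twist` of prelude item C3).  Continuity: if `ρ` is trivial on the open
`U ≤ I_F` then `ρ ⊗ ψ` is trivial on `U ⊓ ker ψ`.  Used to state compatibility of the local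
Langlands correspondence with character twists.
Ref: Deligne, *Les constantes des équations fonctionnelles* (Antwerp II, 1973), §8.4.1;
Tate, *Number theoretic background* (Corvallis 1979), (4.1.4); Harris–Taylor (2001), Thm A(iv). [cite: II1973] -/
def wdTwist (r : GaloisRepresentations.WeilDeligneRep F C W) (ψ : GaloisRepresentations.WeilGroup F →* Cˣ)
    (hψ : IsOpen (ψ.ker : Set (GaloisRepresentations.WeilGroup F))) : GaloisRepresentations.WeilDeligneRep F C W where
  ρ := r.ρ.twist ψ
  isContinuous := by
    obtain ⟨U, hU, hUo, hρ⟩ := r.isContinuous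
    refine ⟨U ⊓ ψ.ker, inf_le_left.trans hU, ?_, fun u hu => ?_⟩
    · rw [Subgroup.coe_inf]
      exact hUo.inter hψ
    · ext v
      rw [Representation.twist_apply, hρ u hu.1, MonoidHom.mem_ker.1 hu.2]
      simp
  N := r.N
  isNilpotent_N := r.isNilpotent_N
  conj_N w := by
    ext v
    simp only [LinearMap.coe_comp, Function.comp_apply, Representation.twist_apply,
      LinearMap.smul_apply, map_smul, r.ρ_N_apply]
    rw [smul_comm]

/-- The representation underlying `wdTwist r ψ hψ` is `r.ρ.twist ψ`. [folklore] -/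
@[simp] theorem wdTwist_ρ (r : GaloisRepresentations.WeilDeligneRep F C W) (ψ : GaloisRepresentations.WeilGroup F →* Cˣ)
    (hψ : IsOpen (ψ.ker : Set (GaloisRepresentations.WeilGroup F))) : (wdTwist r ψ hψ).ρ = r.ρ.twist ψ := rfl

/-- The monodromy of `wdTwist r ψ hψ` is that of `r`. [folklore] -/
@[simp] theorem wdTwist_N (r : GaloisRepresentations.WeilDeligneRep F C W) (ψ : GaloisRepresentations.WeilGroup F →* Cˣ)
    (hψ : IsOpen (ψ.ker : Set (GaloisRepresentations.WeilGroup F))) : (wdTwist r ψ hψ).N = r.N := rfl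

/-- For a smooth character `χ : Fˣ →* ℂˣ` (open kernel) and a local Artin datum `d`, the
character `χ ∘ artin : W_F →* ℂˣ` — the local Langlands correspondent `d.recGL1 χ` of `χ` for
`GL₁` (`LocalArtinData.recGL1`, prelude G09) — has open kernel, `artin` being continuous.
Ref: Tate, *Number theoretic background* (Corvallis 1979), (1.4.5), (2.1). [cite: Corvallis1979] -/
theorem isOpen_ker_comp_artin (d : GaloisRepresentations.LocalArtinData F) {χ : Fˣ →* ℂˣ}
    (hχ : IsOpen (χ.ker : Set Fˣ)) : IsOpen ((χ.comp d.artin).ker : Set (GaloisRepresentations.WeilGroup F)) := by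
  have h : ((χ.comp d.artin).ker : Set (GaloisRepresentations.WeilGroup F)) = d.artin ⁻¹' (χ.ker : Set Fˣ) := by
    ext w
    simp [MonoidHom.mem_ker]
  rw [h]
  exact hχ.preimage d.continuous_artin

end WDTwist

section S09


/-- **lang.S09**
weak form (no L/ε-factors of pairs, hence no uniqueness clause).
(Harris–Taylor, *The geometry and cohomology of some simple Shimura varieties* (2001), Thm A;
Henniart, Invent. Math. 139 (2000); Scholze, Invent. Math. 192 (2013), Thm 1.2.)

**The local Langlands correspondence for `GL_n` over the non-archimedean local field `F`.**
Fix a local Artin datum `d` (local class field theory, prelude G09; Deligne's normalisation: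
geometric Frobenius ↦ uniformiser).  There is a family of maps `rec = (rec_n)_n` sending a
complex representation `ρ` of `GL_n(F)` on `V : Type` to an `n`-dimensional complex
Weil–Deligne representation `rec_n ρ` on `ℂⁿ` (`Literature.WeilDeligneRep F ℂ (Fin n → ℂ)`; values on
non-(smooth irreducible) `ρ` are junk) such that:

* (a) every `rec_n ρ` is Frobenius-semisimple;
* (b) `rec_n` respects isomorphism: `ρ ≃ ρ'` (Mathlib `Representation.Equiv`) implies
  `rec_n ρ ≃ rec_n ρ'` (`WeilDeligneRep.IsEquivalent`);
* (c) restricted to smooth irreducible `ρ`, `rec_n` induces a *bijection* onto isomorphism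
  classes of Frobenius-semisimple `n`-dimensional Weil–Deligne representations: every such
  representation is `≃ rec_n ρ` for some smooth irreducible `ρ`, and smooth irreducible
  `ρ, ρ'` with `rec_n ρ ≃ rec_n ρ'` are isomorphic;
* (d) `n = 1` (compatibility with local class field theory): if `GL₁(F)` acts on the
  irreducible `V` through the smooth character `χ : Fˣ →* ℂˣ` (open kernel) composed with `det`,
  then `rec₁ ρ ≃ (χ ∘ artin, N = 0)`, i.e. the character `d.recGL1 χ` of `W_F`
  (`LocalArtinData.recGL1`) as a Weil–Deligne representation (the twist `wdTwist` of the
  trivial one-dimensional Weil–Deligne representation by `χ ∘ artin`);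
* (e) twists: for a smooth character `χ : Fˣ →* ℂˣ`,
  `rec_n (ρ ⊗ (χ ∘ det)) ≃ rec_n ρ ⊗ (χ ∘ artin)` (`Representation.twist` of prelude C3 with
  `Matrix.GeneralLinearGroup.det`, and `wdTwist`);
* (f) central characters: if the central element `a · 1 ∈ GL_n(F)`, `a = artin w`
  (`Matrix.GeneralLinearGroup.scalar`), acts on the smooth irreducible `ρ` by the scalar `c`,
  then `det (rec_n ρ)(w) = c` (`LinearMap.det`), i.e. `ω_ρ ∘ artin = det ∘ rec_n ρ`;
* (g) unramified case: if the smooth irreducible `ρ` has Satake parameters `α`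
  (`IsSatakeParameter ρ ϖ α`, prelude C7, `ϖ` a uniformiser) then `rec_n ρ` is unramified with
  `N = 0` and every *geometric* Frobenius `w` (`WeilGroup.deg w = -1`) acts by a diagonalisable
  matrix with eigenvalue multiset `α`.  (Geometric, not arithmetic, Frobenius: this is forced by
  (d) and the normalisations of `LocalArtinData` and `IsSatakeParameter`, under which for `n = 1`
  and `χ` unramified `α = {χ(ϖ)} = {χ (artin w)}` for `deg w = -1`.)

**Not stated (weak form):** preservation of `L`- and `ε`-factors of pairs
(`rankin_selberg_local_factors`, tier L), and therefore the uniqueness of `rec`, which in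
Henniart's characterisation depends on them.  Universe: representation spaces `V : Type`.
Source of the tag: Harris–Taylor 2001, Introduction, Theorem A ("A local Langlands correspondence
`rec_K` exists for any finite extension `K/ℚ_p`", with the list of properties (1)–(7) preceding it,
p. 2–3 of the Introduction); for `F` of positive characteristic the correspondence is
Laumon–Rapoport–Stuhler (Invent. Math. 113 (1993)).
[cite: HarrisTaylorAMS2001, Introduction, Theorem A] -/
def localLanglands_gl_weak : Prop :=
  ∀ (d : GaloisRepresentations.LocalArtinData F),
    ∃ rec : (n : ℕ) → (V : Type) → [AddCommGroup V] → [Module ℂ V] →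
        Representation ℂ (GL (Fin n) F) V → GaloisRepresentations.WeilDeligneRep F ℂ (Fin n → ℂ),
      ∀ n : ℕ,
      -- (a) Frobenius-semisimplicity
      (∀ (V : Type) [AddCommGroup V] [Module ℂ V] (ρ : Representation ℂ (GL (Fin n) F) V),
          (rec n V ρ).IsFrobSemisimple) ∧
      -- (b) isomorphism invariance
      (∀ (V : Type) [AddCommGroup V] [Module ℂ V] (V' : Type) [AddCommGroup V'] [Module ℂ V']
          (ρ : Representation ℂ (GL (Fin n) F) V) (ρ' : Representation ℂ (GL (Fin n) F) V'),
          Nonempty (ρ.Equiv ρ') → (rec n V ρ).IsEquivalent (rec n V' ρ')) ∧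
      -- (c) surjectivity onto Frobenius-semisimple classes from smooth irreducibles
      (∀ r : GaloisRepresentations.WeilDeligneRep F ℂ (Fin n → ℂ), r.IsFrobSemisimple →
          ∃ (V : Type) (_ : AddCommGroup V) (_ : Module ℂ V) (ρ : Representation ℂ (GL (Fin n) F) V),
            ρ.IsSmooth ∧ ρ.IsIrreducible ∧ (rec n V ρ).IsEquivalent r) ∧
      -- (c) injectivity on isomorphism classes of smooth irreducibles
      (∀ (V : Type) [AddCommGroup V] [Module ℂ V] (V' : Type) [AddCommGroup V'] [Module ℂ V']
          (ρ : Representation ℂ (GL (Fin n) F) V) (ρ' : Representation ℂ (GL (Fin n) F) V'),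
          ρ.IsSmooth → ρ.IsIrreducible → ρ'.IsSmooth → ρ'.IsIrreducible →
          (rec n V ρ).IsEquivalent (rec n V' ρ') → Nonempty (ρ.Equiv ρ')) ∧
      -- (d) `n = 1`: local class field theory
      (∀ (χ : Fˣ →* ℂˣ) (hχ : IsOpen (χ.ker : Set Fˣ)) (V : Type) [AddCommGroup V] [Module ℂ V]
          (ρ : Representation ℂ (GL (Fin 1) F) V), ρ.IsIrreducible →
          (∀ (g : GL (Fin 1) F) (v : V),
              ρ g v = ((χ (Matrix.GeneralLinearGroup.det g) : ℂˣ) : ℂ) • v) →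
          (rec 1 V ρ).IsEquivalent
            (wdTwist (GaloisRepresentations.WeilDeligneRep.trivial ℂ (Fin 1 → ℂ)) (χ.comp d.artin)
              (isOpen_ker_comp_artin d hχ))) ∧
      -- (e) compatibility with character twists
      (∀ (χ : Fˣ →* ℂˣ) (hχ : IsOpen (χ.ker : Set Fˣ)) (V : Type) [AddCommGroup V] [Module ℂ V]
          (ρ : Representation ℂ (GL (Fin n) F) V), ρ.IsSmooth → ρ.IsIrreducible →
          (rec n V (ρ.twist (χ.comp Matrix.GeneralLinearGroup.det))).IsEquivalent
            (wdTwist (rec n V ρ) (χ.comp d.artin) (isOpen_ker_comp_artin d hχ))) ∧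
      -- (f) central character = det ∘ rec via artin
      (∀ (V : Type) [AddCommGroup V] [Module ℂ V] (ρ : Representation ℂ (GL (Fin n) F) V),
          ρ.IsSmooth → ρ.IsIrreducible → ∀ (w : GaloisRepresentations.WeilGroup F) (c : ℂ),
          ρ (Matrix.GeneralLinearGroup.scalar (Fin n) (d.artin w)) = c • LinearMap.id →
          LinearMap.det ((rec n V ρ).ρ w) = c) ∧
      -- (g) unramified representations
      (∀ (V : Type) [AddCommGroup V] [Module ℂ V] (ρ : Representation ℂ (GL (Fin n) F) V),
          ρ.IsSmooth → ρ.IsIrreducible → ∀ (ϖ : Fˣ), (valuation F).IsUniformizer (ϖ : F) →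
          ∀ α : Multiset ℂ, IsSatakeParameter ρ ϖ α →
          (rec n V ρ).N = 0 ∧ IsUnramifiedRep (rec n V ρ).ρ ∧
          ∀ w : GaloisRepresentations.WeilGroup F, deg w = -1 →
            ∃ (g : GL (Fin n) ℂ) (e : Fin n → ℂ),
              LinearMap.toMatrix' ((rec n V ρ).ρ w) =
                (g : Matrix (Fin n) (Fin n) ℂ) * Matrix.diagonal e *
                  ((g⁻¹ : GL (Fin n) ℂ) : Matrix (Fin n) (Fin n) ℂ) ∧
              Multiset.map e Finset.univ.val = α)

end S09

end Literature.NumberTheory.Automorphic
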